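import Literature.IUT.LogThetaLattice.GlobalLGPFrobenioidsCategorical
import HarnessLib

/-!
# [IUTchIII] Proposition 3.7 (v) at the CATEGORY level, C: arithmetic degrees and global log-volumes of the
# categorical Θ-pilot object ([FrdI] Prop. 5.3 "arithmetic degree" junction; SUBDAG-IUTchIII-Prop-37 row r20)
# (abc-iut cell, layer L6, typer-of-record lineage abc-iut-L6-t4; proof-only companion of
# `GlobalLGPFrobenioidsCategorical.lean`)

S. Mochizuki, *Inter-universal Teichmüller theory III*, kurims manuscript (May 2020), §3, Proposition 3.7 (v)
p. 112 l. 1–8 and Definition 3.8 (i) p. 112 l. 26–35 [claim: Mochizuki2012, status: disputed] ("its realification,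
regarded as an object of `†𝒞^⊩_LGP` or `†𝒞^⊩_lgp`"), with Proposition 3.9 (iii) p. 117 (global log-volume = degree
of the arithmetic line bundle "relative to a suitable normalization") and [FrdI] Prop. 5.3 p. 103 / Thm. 6.4 (i)
p. 114 (the realification and its arithmetic degree `δ_A : Pic_Φ(A) ⥲ ℝ`) [cite: MochizukiFrdI2008, Prop. 5.3 p.103];
T. Dupuy, A. Hilado, *The statement of Mochizuki's Corollary 3.12*, Def. 3.1.1, §3.3 (`deĝ_lgp`, `P_q`, `P_Θ`)
[cite: DupuyHilado2025, §3.3].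

PROOF-ONLY (no definition). §0: the weighted-diagonal embedding `embDiag` of part A is NOT FULL as a functor
into the product category once `l⋆ ≥ 2` (`embDiag_not_full`: a family of morphisms with DIFFERENT Frobenius
degrees in two labels lies in `Π_j (†𝓕⊛ℝ_MOD)_j` but not in the image) — so `†𝒞^⊩_LGP ⊆ Π_j (†𝓕⊛ℝ_MOD)_j` is a
genuine NON-full "subcategory … whose divisor and rational function monoids are determined … by the vector of
ratios" ([IUTchII] Cor. 4.5 (v) p. 133), exactly as part A's `exists_preimage_of_diagonal` (full onto COMMON-degree
weighted-diagonal morphisms) delimits it. §1: for abc-iut-L6-t4's categorical inhabitant `frobenioidSignature X` of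
`GlobalLGPFrobenioidSignature` (`GlobalLGPFrobenioidsCategorical.lean`) and the printed splitting monoids
`Ψ^⊥_v = μ_{2l}^{diag}·(ζ_j q̲_v^{j²})_j^ℕ` (`SplittingMonoids.dhRoot`), the NUMBERS attached to the Θ-pilot object of
Definition 3.8 (i): the arithmetic degree (abc-iut-L6-d3's `frakDeg`, = global log-volume by
`globalLogVolume_frakRegion`, Prop. 3.9 (iii) at the model) of the object of `†𝒞^⊩_lgp` is `−deĝ_F(P_q)`
(`frakDeg_thetaPilotObject_frobenioidSignature`), that of its `j`-th embedded component in `(†𝓕⊛ℝ_MOD)_j` is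
`−j²·deĝ_F(P_q) = −deĝ_F(P_{Θ,j})` (`frakDeg_embLGP_thetaPilotObject`), and the uniform average over `j ∈ 𝔽_l^⋇` is
`−deĝ_lgp(P_Θ) = −((l⋆+1)(2l⋆+1)/6)·deĝ_F(P_q) = −((l+1)/24)·deĝ_F(𝔮)` (`avg_frakDeg_embLGP_thetaPilotObject(_closed)`;
abc-iut-c312-3's `degLgp_thetaPilot(_closed)`, the coefficient printed in [IUTchIV] Thm. 1.10, Step (v)).
Nothing here asserts a disputed claim or takes a side on [IUTchIII] Cor. 3.12; typed ≠ discharged; instantiated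
≠ endorsed.
-/

noncomputable section

namespace Literature.IUT.LogThetaLattice

namespace Prop37

open CategoryTheory NumberField IsDedekindDomain GlobalFrobenioidModels Literature.IUT.LogVolume
open Literature.IUT.HodgeArakelov Literature.NumberTheory.EllipticCurves

/-! ### §0 The weighted diagonal is a non-full subcategory -/

/-- **`embDiag` is not full** (`l⋆ ≥ 2`): the endomorphism family `((1, 0), (2, 0), (2, 0), …)` of the embedded zero
object in `Π_j (†𝓕⊛ℝ_MOD)_j` has different Frobenius degrees in the labels `j = 1, 2`, so it is not of the form
`(n, j²·u)_j` — the weighted diagonal of [IUTchII] Cor. 4.5 (v) / Rmk. 4.5.4 is a NON-full subcategory of the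
product category. [claim: Mochizuki2012, status: disputed] -/
theorem embDiag_not_full (F : Type) [Field F] [NumberField F] {lstar : ℕ} (hl : 2 ≤ lstar) :
    ¬ (embDiag F lstar).Full := by
  intro hfull
  have h0 : 0 < lstar := lt_of_lt_of_le two_pos hl
  have h1 : 1 < lstar := lt_of_lt_of_le one_lt_two hl
  let Z : FrakRlfCat F := FrakRlfCat.of 0
  have heff' : ∀ (i : Fin lstar) (n : ℕ+), (0 : ModelFrakObj F) + (n : ℕ) • ((embDiag F lstar).obj Z i).obj -
      ((embDiag F lstar).obj Z i).obj ∈ effDiv (ModelPlaces F) (fun _ => ℝ) nonnegModel := by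
    intro i n
    rw [embDiag_obj_obj, FrakRlfCat.obj_of, nsmul_zero, nsmul_zero, zero_add, sub_zero]
    exact (effDiv (ModelPlaces F) (fun _ => ℝ) nonnegModel).zero_mem
  let ψ : (embDiag F lstar).obj Z ⟶ (embDiag F lstar).obj Z := fun i =>
    FrakRlfCat.homMk (if (i : ℕ) = 0 then 1 else 2) 0 (realRatFn F).zero_mem (heff' i _)
  obtain ⟨φ, hφ⟩ := hfull.map_surjective ψ
  have hd0 : FrakRlfCat.deg φ = 1 := by
    have h := congrArg (fun η : (embDiag F lstar).obj Z ⟶ (embDiag F lstar).obj Z => FrakRlfCat.deg (η ⟨0, h0⟩)) hφ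
    simpa [ψ] using h
  have hd1 : FrakRlfCat.deg φ = 2 := by
    have h := congrArg (fun η : (embDiag F lstar).obj Z ⟶ (embDiag F lstar).obj Z => FrakRlfCat.deg (η ⟨1, h1⟩)) hφ
    simpa [ψ] using h
  rw [hd0] at hd1
  exact absurd hd1 (by decide)

variable {F : Type} [Field F] [NumberField F] (X : PilotData F)
  (τ : ∀ v ∈ X.S, (v.adicCompletion F)ˣ)
  (hτ : ∀ v (hv : v ∈ X.S), ‖(τ v hv : v.adicCompletion F)‖ < 1 ∧
    tateJ (τ v hv : v.adicCompletion F) = (X.jE : v.adicCompletion F))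
  (ρ : ∀ v ∈ X.S, (v.adicCompletion F)ˣ) (hρ : ∀ v (hv : v ∈ X.S), ρ v hv ^ (2 * X.l) = τ v hv)
  (ζ : ∀ v ∈ X.S, Fin X.lstar → ((v.adicCompletion F)ˣ)ˣ)
  (hζ : ∀ v (hv : v ∈ X.S) (i : Fin X.lstar), ζ v hv i ∈ rootsOfUnity (2 * X.l) ((v.adicCompletion F)ˣ))

include hτ hρ hζ in
/-- **The arithmetic degree of the categorical Θ-pilot object of `†𝒞^⊩_lgp`** ([FrdI] Thm. 6.4 (i) degree of an
object of the realification; abc-iut-L6-d3's `frakDeg`): `−deĝ_F(P_q)` (abc-iut-c312-3's `q`-pilot divisor, the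
label-`1` theta pilot `P_{Θ,1} = 1²·P_q`). [claim: Mochizuki2012, status: disputed] -/
theorem frakDeg_thetaPilotObject_frobenioidSignature :
    frakDeg (thetaPilotObject (frobenioidSignature X) (SplittingMonoids.dhRoot X ρ ζ)).obj =
      -FinDivisor.deg F X.qPilot := by
  rw [thetaPilotObject_frobenioidSignature X τ hτ ρ hρ ζ hζ, FrakRlfCat.obj_of, frakDeg_ofFinDivisorFrak]

include hτ hρ hζ in
/-- **[IUTchIII] Prop. 3.9 (iii) for the categorical Θ-pilot object**: its global log-volume (region of the
underlying real family of fractional ideals, abc-iut-L6-d3's `frakRegion` / `globalLogVolume_frakRegion`) is the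
degree `−deĝ_F(P_q)`. [claim: Mochizuki2012, status: disputed] -/
theorem globalLogVolume_thetaPilotObject_frobenioidSignature :
    globalLogVolume (divisorLogVolume F)
        (frakRegion (thetaPilotObject (frobenioidSignature X) (SplittingMonoids.dhRoot X ρ ζ)).obj) =
      -FinDivisor.deg F X.qPilot := by
  rw [globalLogVolume_frakRegion, frakDeg_thetaPilotObject_frobenioidSignature X τ hτ ρ hρ ζ hζ]

include hτ hρ hζ in
/-- **The degrees of the embedded components** (Prop. 3.7 (v) realified product embedding, weight `j²` on the
`j`-th factor `(†𝓕⊛ℝ_MOD)_j`): `−deĝ_F(P_{Θ,j}) = −j²·deĝ_F(P_q)`. [claim: Mochizuki2012, status: disputed] -/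
theorem frakDeg_embLGP_thetaPilotObject (i : Fin X.lstar) :
    frakDeg ((frobenioidSignature X).embLGP
        (thetaPilotObject (frobenioidSignature X) (SplittingMonoids.dhRoot X ρ ζ)) i).obj =
      -FinDivisor.deg F (X.thetaPilot i) := by
  rw [embLGP_thetaPilotObject_frobenioidSignature X τ hτ ρ hρ ζ hζ]
  exact frakDeg_ofFinDivisorFrak _

include hτ hρ hζ in
/-- … equivalently `−(j² · deĝ_F(P_q))` (abc-iut-c312-3's `deg_thetaPilot`). [claim: Mochizuki2012, status: disputed] -/
theorem frakDeg_embLGP_thetaPilotObject' (i : Fin X.lstar) :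
    frakDeg ((frobenioidSignature X).embLGP
        (thetaPilotObject (frobenioidSignature X) (SplittingMonoids.dhRoot X ρ ζ)) i).obj =
      -((((i : ℕ) + 1 : ℝ) ^ 2) * FinDivisor.deg F X.qPilot) := by
  rw [frakDeg_embLGP_thetaPilotObject X τ hτ ρ hρ ζ hζ, PilotData.deg_thetaPilot]

include hτ hρ hζ in
/-- **The uniform average of the degrees of the embedded components is `−deĝ_lgp(P_Θ)`** (Dupuy–Hilado's
lgp-degree, "simply the uniform average of the degrees of its components"; the procession-normalised average
over `j ∈ 𝔽_l^⋇` of [IUTchIII] Prop. 3.9 / [IUTchI] Prop. 4.11) `= −((l⋆+1)(2l⋆+1)/6)·deĝ_F(P_q)`.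
[cite: DupuyHilado2025, Def. 3.1.1, §3.3] -/
theorem avg_frakDeg_embLGP_thetaPilotObject :
    (1 / (X.lstar : ℝ)) * ∑ i : Fin X.lstar, frakDeg ((frobenioidSignature X).embLGP
        (thetaPilotObject (frobenioidSignature X) (SplittingMonoids.dhRoot X ρ ζ)) i).obj =
      -((((X.lstar : ℝ) + 1) * (2 * X.lstar + 1) / 6) * FinDivisor.deg F X.qPilot) := by
  simp only [frakDeg_embLGP_thetaPilotObject X τ hτ ρ hρ ζ hζ, Finset.sum_neg_distrib, mul_neg]
  rw [← X.degLgp_thetaPilot, LgpDivisor.degLgp]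

include hτ hρ hζ in
/-- … in closed form `−((l+1)/24)·deĝ_F(𝔮)` with `𝔮 = Σ_{v∈S} ord_v(q_v)[v]` — the coefficient "`(l+1)/24`" printed in
[IUTchIV] Thm. 1.10, Step (v) (abc-iut-c312-3's `degLgp_thetaPilot_closed`). [cite: DupuyHilado2025, Def. 3.1.1, §3.3] -/
theorem avg_frakDeg_embLGP_thetaPilotObject_closed :
    (1 / (X.lstar : ℝ)) * ∑ i : Fin X.lstar, frakDeg ((frobenioidSignature X).embLGP
        (thetaPilotObject (frobenioidSignature X) (SplittingMonoids.dhRoot X ρ ζ)) i).obj =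
      -((((X.l : ℝ) + 1) / 24) * FinDivisor.deg F X.qDivisor) := by
  simp only [frakDeg_embLGP_thetaPilotObject X τ hτ ρ hρ ζ hζ, Finset.sum_neg_distrib, mul_neg]
  rw [← X.degLgp_thetaPilot_closed, LgpDivisor.degLgp]

include hτ hρ hζ in
/-- The Θ-side degree average is STRICTLY BELOW the degree of the `†𝒞^⊩_lgp`-object itself (`deĝ(P_q) <
deĝ_lgp(P_Θ)`, abc-iut-c312-3's `deg_qPilot_lt_degLgp_thetaPilot`): the weights `j²` matter.
[cite: DupuyHilado2025, §3.3] -/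
theorem avg_frakDeg_embLGP_lt_frakDeg_thetaPilotObject :
    (1 / (X.lstar : ℝ)) * ∑ i : Fin X.lstar, frakDeg ((frobenioidSignature X).embLGP
        (thetaPilotObject (frobenioidSignature X) (SplittingMonoids.dhRoot X ρ ζ)) i).obj <
      frakDeg (thetaPilotObject (frobenioidSignature X) (SplittingMonoids.dhRoot X ρ ζ)).obj := by
  rw [frakDeg_thetaPilotObject_frobenioidSignature X τ hτ ρ hρ ζ hζ]
  simp only [frakDeg_embLGP_thetaPilotObject X τ hτ ρ hρ ζ hζ, Finset.sum_neg_distrib, mul_neg]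
  rw [← LgpDivisor.degLgp, neg_lt_neg_iff]
  exact X.deg_qPilot_lt_degLgp_thetaPilot

end Prop37

end Literature.IUT.LogThetaLattice

end
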